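import Literature.NumberTheory.EllipticCurves.DeShalitThetaTExpansionColemanBridge
import HarnessLib

/-!
# The bridge identity for a FAMILY of units with ONE Tate unit: `∃ a, ∀ j, g_{β_j} = (G_j ∘ [1]_{P′,f}) ∘ [a]_f`
# (de Shalit II.4.4 (iv) + II.4.9 (ii) assembled — quantifier order; proofs only)

Topic `NumberTheory/EllipticCurves` (theorems only; no definition, no named fact, no instance).  Cell `bsd-print-cf2`, width seat
`bsd-line-cf2-p1-w2` g25, piece (β)-FAM.

`DeShalitThetaTExpansionColemanBridge.exists_unit_relColemanSeries_eq_subst_subst_of_divisionPoints` (brick B10b) binds the Tate-module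
unit `a` under `∃` for EACH unit `β`.  But the unit `a` of `FormalGroupLubinTateDivisionPointsTateUnit.exists_unit_forall_ptOfZ_hom_hom_cohPt_eq`
(brick B10a) depends only on the coherent torsion points `U_m` (de Shalit's `ξ(u_{m+1})`, `u_n = βⁿΩ − Ω/π₀ⁿ`: a function of the base
point `Ω`, the lattice `L = Ω·𝔣` and `π₀ = ψ(𝔭)` — NOT of the ideal `𝔞` indexing the elliptic unit `e(𝔞)`), while the class sums of de Shalit
II.4.14 (38)→(40) need ONE `p`-adic period `Ω_p` (one `a`) for every unit of the sum.  This file states the bridge with the right quantifier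
order:

* (private) `constantCoeff_subst_eq_self_of_constantCoeff_eq_zero'` (`H(0) = 0 ⇒ (G ∘ H)(0) = G(0)`, any commutative ring) and
  ★ `isUnit_of_relColemanSeries_eq_subst_subst` — if `g_β = (G ∘ H₁) ∘ H₂` with `H₁(0) = H₂(0) = 0` then `G` is a unit of `𝒪_E⟦X⟧`
  (`g_β` is one: `isUnit_relColemanSeries`);
* ★★ `exists_unit_forall_relColemanSeries_eq_subst_subst_of_divisionPoints` — B10b's hypotheses with the POINT data (`ψ, W_R, τ, x₀, y₀`,
  `U, hU, hord, hcoh, x_R, y_R`, the chart identity) SHARED and the UNIT data indexed by `j ∈ J` (`β j, G j, T j, K j, x j, u j, e j`, the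
  value identity): **`∃ a ∈ 𝒪_Fˣ, ∀ j, relColemanSeries (β j) = (G j ∘ [1]_{P′,f}) ∘ [a]_f`** — `a` obtained ONCE from B10a, then
  `relColemanSeries_eq_subst_subst_of_semiconj` per unit (the parameter non-vanishing from `addOrderOf U_m = p^{m+1} ≠ 1`, as in B10b).

HONEST FRAMING: a re-packaging of accepted kernel theorems (B10a, V1+V2); nothing here closes a crux; no summit statement is proved;
BSD is not proved by any of this.

## References
* [deShalit1987] E. de Shalit, *Iwasawa theory of elliptic curves with complex multiplication* (1987), I §2.2 Theorem, II §4.4 (iv), (12),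
  II §4.9 Proposition (ii) and proof (p. 63), II §4.14 (38) (p. 71: one `Ω_p` for the whole class sum).
* [CasselsFrohlichANT1967] J.-P. Serre, *Local class field theory* (Cassels–Fröhlich Ch. VI), §3.5–3.6.
-/

noncomputable section

open scoped Classical
open PowerSeries

namespace Literature.NumberTheory.EllipticCurves

open ValuativeRel Literature.NumberTheory.GaloisRepresentations
  Literature.NumberTheory.GaloisRepresentations.IsNonarchimedeanLocalField
  Literature.NumberTheory.GaloisRepresentations.LubinTate Field
open Literature.NumberTheory.EllipticCurves.FormalGroupChart _root_.WeierstrassCurve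

/-- `(G ∘ H)(0) = G(0)` when `H(0) = 0` (any commutative ring). [folklore] -/
private theorem constantCoeff_subst_eq_self_of_constantCoeff_eq_zero' {A : Type*} [CommRing A] {H : PowerSeries A}
    (hH : PowerSeries.constantCoeff H = 0) (G : PowerSeries A) :
    PowerSeries.constantCoeff (G.subst H) = PowerSeries.constantCoeff G := by
  have hs : PowerSeries.HasSubst H := PowerSeries.HasSubst.of_constantCoeff_zero' hH
  have h := PowerSeries.constantCoeff_subst hs G
  rw [finsum_eq_single _ 0 (fun d hd => by
    rw [map_pow, show MvPowerSeries.constantCoeff H = PowerSeries.constantCoeff H from rfl, hH, zero_pow hd,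
      smul_zero])] at h
  rw [pow_zero, map_one, PowerSeries.coeff_zero_eq_constantCoeff, smul_eq_mul, mul_one] at h
  exact h

section Family

variable {F : Type} [Field F] [ValuativeRel F] [TopologicalSpace F] [IsNonarchimedeanLocalField F]

attribute [local instance] ltNormUniformSpace ltNormIsUniformAddGroup rk1 nF nE fintypeResidueField

/-- ★ **If `g_β = (G ∘ H₁) ∘ H₂` with `H₁(0) = H₂(0) = 0`, then `G ∈ 𝒪_E⟦X⟧ˣ`** (`g_β(0) = G(0)` and `g_β` is a unit).
[cite: deShalit1987, I §2.2 Theorem, I §2.3 (i)] -/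
theorem isUnit_of_relColemanSeries_eq_subst_subst {π : 𝒪[F]} (hπ : (valuation F).IsUniformizer (π : F))
    (E : IntermediateField F (AlgebraicClosure F)) [FiniteDimensional F E] [IsGalois F E]
    (hq : residueFieldCard F = 2) (hE : E ≤ maxUnramified F) {σ₀ : absoluteGaloisGroup F} (hσ₀ : IsAbsArithFrob σ₀)
    (β : RelNormCoherentUnits hπ E) {G H₁ H₂ : PowerSeries (unitBall E)}
    (hH₁ : PowerSeries.constantCoeff H₁ = 0) (hH₂ : PowerSeries.constantCoeff H₂ = 0)
    (hβ : relColemanSeries hπ E hq hE hσ₀ β = PowerSeries.subst H₂ (PowerSeries.subst H₁ G)) : IsUnit G := by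
  rw [PowerSeries.isUnit_iff_constantCoeff]
  have h := isUnit_constantCoeff_relColemanSeries hπ E hq hE hσ₀ β
  rwa [hβ, constantCoeff_subst_eq_self_of_constantCoeff_eq_zero' hH₂,
    constantCoeff_subst_eq_self_of_constantCoeff_eq_zero' hH₁] at h

variable {p : ℕ} [Fact p.Prime] (e : 𝒪[F] ≃+* ℤ_[p]) (hq : residueFieldCard F = p)
  {π : 𝒪[F]} (hπ : (valuation F).IsUniformizer (π : F)) {πZ : ℤ_[p]} (he : e π = πZ)
  (hA : IsLTRing πZ p) {P : PowerSeries ℤ_[p]} (hP : IsLTSeries πZ p P)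
  {V : WeierstrassCurve ℤ_[p]} (hV : V.formalGroupLaw = ltF hA hP) {ϖ : ℤ_[p]} (hp : (p : ℤ_[p]) = ϖ * πZ) (hϖ : IsUnit ϖ)
  (E : IntermediateField F (AlgebraicClosure F)) [FiniteDimensional F E] [Normal F E] [IsGalois F E]
  (hq2 : residueFieldCard F = 2) (hE : E ≤ maxUnramified F) {σ₀ : absoluteGaloisGroup F} (hσ₀ : IsAbsArithFrob σ₀)

include hV hp hϖ in
set_option maxHeartbeats 800000 in
/-- ★★ **`∃ a, ∀ j, g_{β_j} = (G_j ∘ [1]_{P′,f}) ∘ [a]_f` — the bridge identity for a family of units with ONE Tate unit.**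
Shared data: the lane datum, the reading `ψ : R → 𝒪_E` with `W_R ⊗_ψ 𝒪_E = V ⊗ 𝒪_E`, the semiconjugating endomorphism `τ`
(`φ⁻¹ ∘ ψ = ψ ∘ τ`, `W_R^τ = W_R`), the base point `(x₀, y₀)`, de Shalit's coherent division points `U_m ∈ E₁(M_m)` of exact order `p^{m+1}`,
the points `(x_R^{(m)}, y_R^{(m)})` and the chart identity `(ψτ^{m+1}x₀, ψτ^{m+1}y₀) − U_m = (x_R^{(m)}, y_R^{(m)})`.  Per unit `j`: `β j`,
its presentation `G j = ψ(Q_R(x₀, y₀; x j; K j))` on the index set `T j` (`τ (K j) = K j`, `τ` permutes the `x j c` through `e j`), and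
the value identity `ψ(K j)·∏((x_R^{(m)} − ψ(x j c))⁻¹)⁶ = (β j)_m`.  Conclusion: ONE `a ∈ 𝒪_Fˣ` with `g_{β j} = (G j ∘ [1]_{P′,f}) ∘ [a]_f`
for all `j` (de Shalit II.4.14 (38): one `Ω_p` for the class sum).
[cite: deShalit1987, I §2.2 Theorem, II §4.4 (iv), (12), II §4.9 Proposition (ii), II §4.14 (38)] [cite: CasselsFrohlichANT1967, Ch. VI §3.5–3.6] -/
theorem exists_unit_forall_relColemanSeries_eq_subst_subst_of_divisionPoints
    [hEll : ∀ m : ℕ, (curveOver (E ⊔ ltField π m : IntermediateField F (AlgebraicClosure F))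
      (V.map ((LTCoeff.of F).toRingHom.comp e.symm.toRingHom))).IsElliptic]
    -- shared: the reading, the model, the semiconjugating endomorphism, the base point
    {R : Type*} [CommRing R] (ψ : R →+* unitBall E) (WR : WeierstrassCurve R)
    (hWR : WR.map ψ = (V.map ((LTCoeff.of F).toRingHom.comp e.symm.toRingHom)).map (algebraMap (LTCoeff F) (unitBall E)))
    (τ : R →+* R) (hτ : ((frobUnitBall E σ₀).symm : unitBall E →+* unitBall E).comp ψ = ψ.comp τ)
    (hWτ : WR.map τ = WR) (x₀ y₀ : R)
    -- shared: de Shalit's division points on the lane curve, levelwise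
    (U : ∀ m : ℕ, (curveOver (E ⊔ ltField π m : IntermediateField F (AlgebraicClosure F))
      (V.map ((LTCoeff.of F).toRingHom.comp e.symm.toRingHom))).toAffine.Point)
    (hU : ∀ m : ℕ, U m ∈ kernel (NormedField.valuation (K := (E ⊔ ltField π m : IntermediateField F (AlgebraicClosure F))))
      (curveOver (E ⊔ ltField π m : IntermediateField F (AlgebraicClosure F)) (V.map ((LTCoeff.of F).toRingHom.comp e.symm.toRingHom))))
    (hord : ∀ m : ℕ, addOrderOf (U m) = p ^ (m + 1))
    (hcoh : ∀ m : ℕ, ltSMul (maxNilIdeal F (E ⊔ ltField π (m + 1) : IntermediateField F (AlgebraicClosure F))) (isLTRing_LTCoeff hπ)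
        (isLTSeries_map_LTCoeff_of_degree_one e hq he hP) (LTCoeff.of F π) (zPt (U (m + 1)) (hU (m + 1))) =
      inclPt (sup_le_sup_left (ltField_mono hπ (Nat.le_succ m)) E) (zPt (U m) (hU m)))
    -- shared: the chart identity at `U_m`
    (xR yR : (m : ℕ) → ↥(E ⊔ ltField π m : IntermediateField F (AlgebraicClosure F)))
    (h₀ : ∀ m : ℕ, (curveOver (E ⊔ ltField π m : IntermediateField F (AlgebraicClosure F))
        (V.map ((LTCoeff.of F).toRingHom.comp e.symm.toRingHom))).toAffine.Nonsingular
      (((inclUnitBall (F := F) (le_sup_left : E ≤ E ⊔ ltField π m) (ψ (τ^[m + 1] x₀)) :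
        unitBall (E ⊔ ltField π m : IntermediateField F (AlgebraicClosure F))) : (E ⊔ ltField π m : IntermediateField F _)))
      (((inclUnitBall (F := F) (le_sup_left : E ≤ E ⊔ ltField π m) (ψ (τ^[m + 1] y₀)) :
        unitBall (E ⊔ ltField π m : IntermediateField F (AlgebraicClosure F))) : (E ⊔ ltField π m : IntermediateField F _))))
    (hR : ∀ m : ℕ, (curveOver (E ⊔ ltField π m : IntermediateField F (AlgebraicClosure F))
      (V.map ((LTCoeff.of F).toRingHom.comp e.symm.toRingHom))).toAffine.Nonsingular (xR m) (yR m))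
    (hpt : ∀ m : ℕ, (.some _ _ (h₀ m) : (curveOver (E ⊔ ltField π m : IntermediateField F (AlgebraicClosure F))
        (V.map ((LTCoeff.of F).toRingHom.comp e.symm.toRingHom))).toAffine.Point) - U m = .some _ _ (hR m))
    -- per unit `j`: the unit, its presentation and its value identity
    {J : Type*} (β : J → RelNormCoherentUnits hπ E) (G : J → PowerSeries (unitBall E))
    {ι : Type*} (T : J → Finset ι) (Kc : J → R) (x : J → ι → R) (u : J → ι → Rˣ)
    (hu : ∀ j, ∀ c ∈ T j, (u j c : R) = x₀ - x j c)
    (hG₀ : ∀ j, G j = PowerSeries.map ψ (C (Kc j) * ∏ c ∈ T j,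
        PowerSeries.invOfUnit ((WR.translateX x₀ y₀).subst WR.formalNeg - C (x j c)) (u j c) ^ 6))
    (hKτ : ∀ j, τ (Kc j) = Kc j) (eι : J → ι → ι) (heT : ∀ j, ∀ c ∈ T j, eι j c ∈ T j) (hinj : ∀ j, Set.InjOn (eι j) (T j))
    (hsurj : ∀ j, Set.SurjOn (eι j) (T j) (T j)) (hx : ∀ j, ∀ c ∈ T j, τ (x j c) = x j (eι j c))
    (hval : ∀ (j : J) (m : ℕ), ((inclUnitBall (F := F) (le_sup_left : E ≤ E ⊔ ltField π m) (ψ (Kc j)) :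
        unitBall (E ⊔ ltField π m : IntermediateField F (AlgebraicClosure F))) : (E ⊔ ltField π m : IntermediateField F _)) *
        ∏ c ∈ T j, ((xR m - (((inclUnitBall (F := F) (le_sup_left : E ≤ E ⊔ ltField π m) (ψ (x j c)) :
          unitBall (E ⊔ ltField π m : IntermediateField F (AlgebraicClosure F))) : (E ⊔ ltField π m : IntermediateField F _))))⁻¹) ^ 6 =
      (((β j).val m : unitBall (E ⊔ ltField π m : IntermediateField F (AlgebraicClosure F))) :
        (E ⊔ ltField π m : IntermediateField F (AlgebraicClosure F)))) :
    ∃ a : 𝒪[F]ˣ, ∀ j : J, relColemanSeries hπ E hq2 hE hσ₀ (β j) =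
      PowerSeries.subst ((hom (isLTRing_LTCoeff hπ) (isLTSeries_LTCoeff _) (isLTSeries_LTCoeff _) (LTCoeff.of F (a : 𝒪[F]))).map
          (algebraMap (LTCoeff F) (unitBall E)))
        (PowerSeries.subst ((hom (isLTRing_LTCoeff hπ) (isLTSeries_map_LTCoeff_of_degree_one e hq he hP) (isLTSeries_LTCoeff _) 1).map
          (algebraMap (LTCoeff F) (unitBall E))) (G j)) := by
  -- ONE Tate unit from the shared torsion points (B10a)
  obtain ⟨a, ha⟩ := exists_unit_forall_ptOfZ_hom_hom_cohPt_eq e hq hπ he hA hP hV hp hϖ E U hU hord hcoh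
  -- the parameter `t_m = h([a]_f ω_{m+1})` is non-zero: `P(t_m) = U_m` has order `p^{m+1} ≠ 1` (shared)
  have ht0 : ∀ m : ℕ, (((evalPt₁ (maxNilIdeal F (E ⊔ ltField π m : IntermediateField F (AlgebraicClosure F)))
      (hom (isLTRing_LTCoeff hπ) (isLTSeries_map_LTCoeff_of_degree_one e hq he hP) (isLTSeries_LTCoeff π) 1)
      (constantCoeff_hom _ _ _ 1)
      (evalPt₁ (maxNilIdeal F (E ⊔ ltField π m : IntermediateField F (AlgebraicClosure F)))
        (hom (isLTRing_LTCoeff hπ) (isLTSeries_LTCoeff π) (isLTSeries_LTCoeff π) (LTCoeff.of F (a : 𝒪[F])))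
        (constantCoeff_hom _ _ _ _)
        (inclPt (le_sup_right : ltField π m ≤ E ⊔ ltField π m) (cohPt hπ m))) :
      (maxNilIdeal F (E ⊔ ltField π m : IntermediateField F (AlgebraicClosure F))).toIdeal) :
      unitBall (E ⊔ ltField π m : IntermediateField F (AlgebraicClosure F))) :
      (E ⊔ ltField π m : IntermediateField F (AlgebraicClosure F))) ≠ 0 := by
    intro m h0
    have h1 : U m = 0 := by rw [← ha m, ptOfZ_of_eq_zero h0]
    have h2 := hord m
    rw [h1, addOrderOf_zero] at h2
    exact absurd h2.symm (ne_of_gt (one_lt_pow₀ (Nat.Prime.one_lt Fact.out) (Nat.succ_ne_zero m)))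
  -- per unit: V1+V2 with that `a`
  refine ⟨a, fun j => relColemanSeries_eq_subst_subst_of_semiconj hπ E hq2 hE hσ₀ (β j) (G j) (constantCoeff_hom _ _ _ 1)
    (constantCoeff_hom _ _ _ _) (V.map ((LTCoeff.of F).toRingHom.comp e.symm.toRingHom)) (fun m => hEll m) ψ WR hWR (T j) (Kc j)
    x₀ y₀ (x j) (u j) (hu j) (hG₀ j) τ hτ hWτ (hKτ j) (eι j) (heT j) (hinj j) (hsurj j) (hx j) ht0 xR yR h₀ hR (fun m _ => ?_)
    (hval j)⟩
  rw [ha m]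
  exact hpt m

end Family

end Literature.NumberTheory.EllipticCurves

end
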